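/-
Copyright (c) 2026 the pub-hodgecm-mathlib formalisation cell (harness21).  Prover seat hodgecm-mathlib-LH4-p13 (g7), req620 Track A «(D-RAM) FOUR-FRAME» squad, tier 0,
STAGE-1b PRE-SCOPING (heir LEAD F0P3a-plan (g20) T19-24 «allowed as scoping»): organ (L-lab) «THE LABEL LAW» of the rows `stub_rows_transvPlus ∕ stub_rows_transvMinus`
— brick (L-lab-0) «THE HERMITIAN VALUE OF A FRAME ELEMENT, AND THE LABEL AS A BINARY NORM-VALUE CLASS».  2026-09-04.
-/
import Literature.NumberTheory.Automorphic.UnitaryThreeFourFrameAxisTypeTwoStep              -- ★ (B-p04): `pairing_frameProj_mulVec_right`; brings ★ H3∕H8 `frameProj`∕`frameElt`, ★ `pairing_comm_of_hermitian`, ★ `map_antidiagonal_three_over_apply_eq`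
import Summits.HodgeConjecture.HodgeConjecture.Theorems.F0P3cDyRamFourFrameCensusDefs        -- ★ U2G DEFS: `latticeValueSetMod`, `LatticeLabelPlus`; brings ★ №3 `valueSetMod`, `xPlus`
import Summits.HodgeConjecture.HodgeConjecture.Theorems.F0P3cDyRamShellLabelPlus              -- ★ (LH4-p03): `pairing_xPlus_mulVec` (`⟨y, X₊y⟩ = t₊·(y₂·σy₂)`)
import HarnessLib

/-!
# Crux `H413`, line LH4 «(D-RAM) FOUR-FRAME», tier 0, STAGE-1b pre-scoping — (L-lab-0): the hermitian value `⟨y, (γ_b − 1)·y⟩` of a frame element and the transvection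
# label `LatticeLabelPlus` at a vertex as the `ϖ^m`-class of a BINARY NORM-VALUE SET

Cell `hodgecm-mathlib` (D-0151), FLOOR 0, crux item H413 = `stmt-HodgeConjecture-24833`, route of record `HCCMUnconditional`; squad F0∕P3c∕LH4.  The three OPEN tier-0 rows
`stub_rows_transvPlus ∕ stub_rows_transvMinus ∕ stub_rows_regular : PieceRowsWild gselStar j` (`Cruxes/H413/Lines/F0_P3c_DyRamFourFrame.lean` ED. 4 @92∕96∕100) are
STAGE-1b debt with NO directive yet (heir LEAD T19-21∕T19-24); this file is SCOPING INVENTORY for the LEAD's PLAN-T1 v19 (L-lab) paragraph — THEOREMS ONLY (no `def`, no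
instance, no notation, no `sorry`, default heartbeats), Mathlib∕★-only imports, lane `--supports stmt-HodgeConjecture-24833 --as helper`; it pays NO row and states NO law.

WHERE THE LABEL ENTERS.  The pieces `f_{T±}` (★ №3 `pieceTransvPlus ∕ pieceTransvMinus`) read, on the near-transvection shell, the label ★ №3 `LabelPlus σ ϖ d m X`
(`X := wMatrix u − 1`): «the `ϖ^m`-thickened set of hermitian values `⟨y, X y⟩_{Φ₃}`, `y` integral, equals that of the reference class-`+` nilpotent ★ `xPlus σ ϖ d = t₊·E₀₂`»;
transported to a vertex `M` it is ★ U2G `LatticeLabelPlus σ ϖ d m M X` (★ `labelPlus_conj_iff_latticeLabelPlus`), and the census functions of the rows are ★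
`transvPlusFixCount ∕ transvMinusFixCount` = `#{type-0 M | γM = M ∧ shell ∧ (¬)LatticeLabelPlus σ ϖ d m M (γ − 1)}`.  On the type-(1) population the literal is
`γ = z·γ_b`, `γ_b = frameElt σ f b α β = 1 + (α−1)π₀ + (β−1)π₁` (★ H8; `π_i = frameProj σ (f b i)`, ★ H3).  LH4-p08 (g7) PRESCOPE c88fa546 §4 (L-lab): «the only place the
hermitian value class enters Track A»; LH4-p07 (g8): «the `T₊` label … the one un-scoped organ».

WHAT IS PROVED (`σ` an involution; `K` any field for §1, valued for §2–§4; NO frame orthogonality and NO unitarity is used — pure sesquilinear algebra):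
* §1 **`pairing_frameElt_sub_one_mulVec`** (+ the one-slot readings `…_of_snd_eq_zero ∕ …_of_fst_eq_zero`): with `s_i := ⟨f b i, y⟩`, `N_i := ⟨f b i, f b i⟩`,
  `⟨y, (γ_b − 1)·y⟩ = (α − 1)·(N₀⁻¹·(s₀·σs₀)) + (β − 1)·(N₁⁻¹·(s₁·σs₁))` — the value of `X = γ_b − 1` at `y` is the BINARY form `(α−1)∕N(f₀)·N ⊕ (β−1)∕N(f₁)·N` evaluated
  at the two frame functionals (★ `⟨x, π y⟩ = N⁻¹⟨f, y⟩⟨x, f⟩` + hermitian symmetry `⟨y, f⟩ = σ⟨f, y⟩`).  Hence the frame index `b` enters the label ONLY through the norm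
  classes `ω N(f b 0), ω N(f b 1) = signPair b` (★ H4∕H7) — the κ-data.
* §2 **`latticeValueSetMod_frameElt_sub_one`**: at ANY `𝒪`-submodule `M`, `latticeValueSetMod σ ϖ m M (γ_b − 1)` is the `ϖ^m`-thickening of
  `{(α−1)N₀⁻¹N(s₀ y) + (β−1)N₁⁻¹N(s₁ y) | y ∈ M}`.
* §3 **`valueSetMod_xPlus`**: the reference set `valueSetMod σ ϖ m (xPlus σ ϖ d)` is the `ϖ^m`-thickening of `t₊·N(𝒪) = {t₊·(a·σa) | |a| ≤ 1}`,
  `t₊ = (ϖ − σϖ)·((ϖσϖ)^{⌊d∕2⌋})⁻¹` (★ `pairing_xPlus_mulVec`, witness `y = (0, 0, a)`).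
* §4 **`latticeLabelPlus_frameElt_sub_one_iff`**: `LatticeLabelPlus σ ϖ d m M (γ_b − 1) ⟺` the two thickened sets of §2 and §3 are equal — the exact object the (L-lab)
  law must evaluate at the shell vertices (next brick: read the functional image `{(⟨f₀,y⟩, ⟨f₁,y⟩) | y ∈ M} ⊆ E²` on ★ A-1's defect-module shape ∕ LH4-p12 (g7)'s
  `(c₁, c₂, k, u)` strata — LH4-p08 (g7)'s hypothesis (O2) as a theorem).
HONEST LABEL.  Count-neutral scoping brick; the three tier-0 rows stay OPEN; `HC_CM` is proved only modulo the 7 printed citations (2 remaining named inputs: hLiu418 =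
`stmt-HodgeConjecture-24832`, h413 = `stmt-HodgeConjecture-24833`) until rung 0 closes.

## References
* [Rogawski1990] J. D. Rogawski, *Automorphic Representations of Unitary Groups in Three Variables*, Ann. of Math. Stud. 123 (1990), §4.9 Prop. 4.9.1 (a)(b) p. 55.
* [Kottwitz1986BaseChangeUnits] R. E. Kottwitz, *Base change for unit elements of Hecke algebras*, Compositio Math. 60 (1986), §3 (fixed points on the building).
* [Jacobowitz1962] R. Jacobowitz, *Hermitian forms over local fields*, Amer. J. Math. 84 (1962), §4 (hermitian lattices, norm classes).
* [LanglandsShelstad1987] R. P. Langlands, D. Shelstad, *On the definition of transfer factors*, Math. Ann. 278 (1987), §3 (the κ-signs of the four frames).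
-/

set_option autoImplicit false

noncomputable section

namespace Summit.HodgeConjecture.HodgeConjecture.Cruxes.H413.F0P3cDyRamFrameEltValueSet

open Literature.NumberTheory.Automorphic Literature.NumberTheory.Automorphic.HermitianLattice
open Literature.NumberTheory.Automorphic.UnitaryLatticeTree Literature.NumberTheory.Automorphic.UnitaryThreeFourFrame
open Summit.HodgeConjecture.HodgeConjecture.Cruxes.H413.F0P3cDyRamFourFramePieces
open Summit.HodgeConjecture.HodgeConjecture.Cruxes.H413.F0P3cDyRamFourFrameCensusDefs
open Summit.HodgeConjecture.HodgeConjecture.Cruxes.H413.F0P3cDyRamShellLabelPlus (pairing_xPlus_mulVec)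
open scoped Matrix WithZero

/-! ## §1  The hermitian value of a frame element -/

section FieldOnly

variable {K : Type} [Field K]

/-- **THE HERMITIAN VALUE OF A FRAME ELEMENT.**  For an involution `σ`, any `f`, `b`, `α`, `β` and any vector `y`, with `s_i := ⟨f b i, y⟩_{Φ₃}` and `N_i := ⟨f b i, f b i⟩_{Φ₃}`:
`⟨y, (γ_b − 1)·y⟩_{Φ₃} = (α − 1)·(N₀⁻¹·(s₀·σ s₀)) + (β − 1)·(N₁⁻¹·(s₁·σ s₁))` — the value of `X = γ_b − 1` is the binary norm form `(α−1)∕N(f₀)·N ⊕ (β−1)∕N(f₁)·N` at the frame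
functionals (no orthogonality, no unitarity used). [cite: Jacobowitz1962, §4] [cite: Rogawski1990, §4.9 Prop. 4.9.1 (b) p. 55] -/
theorem pairing_frameElt_sub_one_mulVec {σ : K →+* K} (hσσ : ∀ a, σ (σ a) = a) (f : Fin 4 → Fin 3 → (Fin 3 → K)) (b : Fin 4) (α β : K)
    (y : Fin 3 → K) :
    pairing σ ((StdForm.antidiagonal 3).over K) y ((frameElt σ f b α β - 1) *ᵥ y) =
      (α - 1) * ((pairing σ ((StdForm.antidiagonal 3).over K) (f b 0) (f b 0))⁻¹ *
          (pairing σ ((StdForm.antidiagonal 3).over K) (f b 0) y * σ (pairing σ ((StdForm.antidiagonal 3).over K) (f b 0) y))) +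
      (β - 1) * ((pairing σ ((StdForm.antidiagonal 3).over K) (f b 1) (f b 1))⁻¹ *
          (pairing σ ((StdForm.antidiagonal 3).over K) (f b 1) y * σ (pairing σ ((StdForm.antidiagonal 3).over K) (f b 1) y))) := by
  have hH := map_antidiagonal_three_over_apply_eq (K := K) σ
  -- `γ_b − 1 = (α − 1)·π₀ + (β − 1)·π₁` (the LEVEL-side algebra of this identity is LH4-p12 (g7)'s brick (A) `FrameEltLevelAlgebra`)
  have h1 : frameElt σ f b α β - 1 = (α - 1) • frameProj σ (f b 0) + (β - 1) • frameProj σ (f b 1) := by rw [frameElt]; abel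
  rw [h1, Matrix.add_mulVec, Matrix.smul_mulVec, Matrix.smul_mulVec, map_add, map_smul, map_smul, smul_eq_mul, smul_eq_mul,
    pairing_frameProj_mulVec_right, pairing_frameProj_mulVec_right, pairing_comm_of_hermitian hσσ hH (f b 0) y, pairing_comm_of_hermitian hσσ hH (f b 1) y]
  ring

/-- The value at a vector ORTHOGONAL to `f b 1` reads the first slot alone: `⟨f b 1, y⟩ = 0 ⇒ ⟨y, (γ_b − 1)y⟩ = (α − 1)·N₀⁻¹·(s₀·σs₀)`. [cite: Jacobowitz1962, §4] -/
theorem pairing_frameElt_sub_one_mulVec_of_snd_eq_zero {σ : K →+* K} (hσσ : ∀ a, σ (σ a) = a) (f : Fin 4 → Fin 3 → (Fin 3 → K)) (b : Fin 4) (α β : K)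
    {y : Fin 3 → K} (hy : pairing σ ((StdForm.antidiagonal 3).over K) (f b 1) y = 0) :
    pairing σ ((StdForm.antidiagonal 3).over K) y ((frameElt σ f b α β - 1) *ᵥ y) =
      (α - 1) * ((pairing σ ((StdForm.antidiagonal 3).over K) (f b 0) (f b 0))⁻¹ *
          (pairing σ ((StdForm.antidiagonal 3).over K) (f b 0) y * σ (pairing σ ((StdForm.antidiagonal 3).over K) (f b 0) y))) := by
  rw [pairing_frameElt_sub_one_mulVec hσσ, hy, map_zero, mul_zero, mul_zero, mul_zero, add_zero]

/-- The value at a vector ORTHOGONAL to `f b 0` reads the second slot alone: `⟨f b 0, y⟩ = 0 ⇒ ⟨y, (γ_b − 1)y⟩ = (β − 1)·N₁⁻¹·(s₁·σs₁)`. [cite: Jacobowitz1962, §4] -/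
theorem pairing_frameElt_sub_one_mulVec_of_fst_eq_zero {σ : K →+* K} (hσσ : ∀ a, σ (σ a) = a) (f : Fin 4 → Fin 3 → (Fin 3 → K)) (b : Fin 4) (α β : K)
    {y : Fin 3 → K} (hy : pairing σ ((StdForm.antidiagonal 3).over K) (f b 0) y = 0) :
    pairing σ ((StdForm.antidiagonal 3).over K) y ((frameElt σ f b α β - 1) *ᵥ y) =
      (β - 1) * ((pairing σ ((StdForm.antidiagonal 3).over K) (f b 1) (f b 1))⁻¹ *
          (pairing σ ((StdForm.antidiagonal 3).over K) (f b 1) y * σ (pairing σ ((StdForm.antidiagonal 3).over K) (f b 1) y))) := by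
  rw [pairing_frameElt_sub_one_mulVec hσσ, hy, map_zero, mul_zero, mul_zero, mul_zero, zero_add]

end FieldOnly

/-! ## §2  The value set of a frame element at a lattice -/

section ValuedField

variable {K : Type} [Field K] [Valued K ℤᵐ⁰]

/-- **THE VALUE SET OF `γ_b − 1` AT A LATTICE.**  For any `𝒪`-submodule `M ⊆ K³`: `latticeValueSetMod σ ϖ m M (γ_b − 1)` is the `ϖ^m`-thickening of the binary norm-value
set `{(α−1)·N₀⁻¹·N(⟨f b 0, y⟩) + (β−1)·N₁⁻¹·N(⟨f b 1, y⟩) | y ∈ M}` (`N(s) = s·σs`). [cite: Rogawski1990, §4.9 Prop. 4.9.1 (b) p. 55] [cite: Kottwitz1986BaseChangeUnits, §3] -/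
theorem latticeValueSetMod_frameElt_sub_one {σ : K →+* K} (hσσ : ∀ a, σ (σ a) = a) (ϖ : K) (m : ℕ) (M : Submodule (Valued.integer K) (Fin 3 → K))
    (f : Fin 4 → Fin 3 → (Fin 3 → K)) (b : Fin 4) (α β : K) :
    latticeValueSetMod σ ϖ m M (frameElt σ f b α β - 1) =
      {z | ∃ y ∈ M, Valued.v ((ϖ ^ m)⁻¹ * (z -
        ((α - 1) * ((pairing σ ((StdForm.antidiagonal 3).over K) (f b 0) (f b 0))⁻¹ *
            (pairing σ ((StdForm.antidiagonal 3).over K) (f b 0) y * σ (pairing σ ((StdForm.antidiagonal 3).over K) (f b 0) y))) +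
         (β - 1) * ((pairing σ ((StdForm.antidiagonal 3).over K) (f b 1) (f b 1))⁻¹ *
            (pairing σ ((StdForm.antidiagonal 3).over K) (f b 1) y * σ (pairing σ ((StdForm.antidiagonal 3).over K) (f b 1) y)))))) ≤ 1} := by
  ext z
  simp only [latticeValueSetMod, Set.mem_setOf_eq, pairing_frameElt_sub_one_mulVec hσσ]

/-! ## §3  The reference value set of `xPlus` -/

/-- **THE REFERENCE SET.**  `valueSetMod σ ϖ m (xPlus σ ϖ d)` = the `ϖ^m`-thickening of `t₊·N(𝒪) = {t₊·(a·σa) | |a| ≤ 1}`, `t₊ = (ϖ − σϖ)·((ϖσϖ)^{⌊d∕2⌋})⁻¹` (★ `xPlus = t₊·E₀₂`,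
`⟨y, X₊y⟩ = t₊·(y₂·σy₂)`; witness `y = (0, 0, a)`). [cite: Rogawski1990, §4.9 Prop. 4.9.1 (b) p. 55] [cite: Jacobowitz1962, §4] -/
theorem valueSetMod_xPlus (σ : K →+* K) (ϖ : K) (d m : ℕ) :
    valueSetMod σ ϖ m (xPlus σ ϖ d) =
      {z | ∃ a : K, Valued.v a ≤ 1 ∧
        Valued.v ((ϖ ^ m)⁻¹ * (z - (ϖ - σ ϖ) * ((ϖ * σ ϖ) ^ ((d - d % 2) / 2))⁻¹ * (a * σ a))) ≤ 1} := by
  ext z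
  simp only [valueSetMod, Set.mem_setOf_eq]
  constructor
  · rintro ⟨y, hy, hz⟩
    exact ⟨y 2, hy 2, by rw [pairing_xPlus_mulVec] at hz; exact hz⟩
  · rintro ⟨a, ha, hz⟩
    refine ⟨![0, 0, a], fun i => ?_, ?_⟩
    · fin_cases i
      · simp
      · simp
      · simpa using ha
    · rw [pairing_xPlus_mulVec]
      simpa using hz

/-! ## §4  The label of a frame element at a vertex is a binary norm-value class -/

/-- **THE LABEL OF A FRAME ELEMENT AS A BINARY NORM-VALUE CLASS.**  At any `𝒪`-submodule `M`: `LatticeLabelPlus σ ϖ d m M (γ_b − 1)` holds iff the `ϖ^m`-thickened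
value set of the binary norm form `(α−1)∕N(f b 0)·N ⊕ (β−1)∕N(f b 1)·N` on the functional image `{(⟨f b 0, y⟩, ⟨f b 1, y⟩) | y ∈ M}` equals the `ϖ^m`-thickening of
`t₊·N(𝒪)` — the object the STAGE-1b label law evaluates at the shell vertices of `transvPlusFixCount ∕ transvMinusFixCount`.
[cite: Rogawski1990, §4.9 Prop. 4.9.1 (b) p. 55] [cite: LanglandsShelstad1987, §3] [cite: Kottwitz1986BaseChangeUnits, §3] -/
theorem latticeLabelPlus_frameElt_sub_one_iff {σ : K →+* K} (hσσ : ∀ a, σ (σ a) = a) (ϖ : K) (d m : ℕ) (M : Submodule (Valued.integer K) (Fin 3 → K))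
    (f : Fin 4 → Fin 3 → (Fin 3 → K)) (b : Fin 4) (α β : K) :
    LatticeLabelPlus σ ϖ d m M (frameElt σ f b α β - 1) ↔
      {z | ∃ y ∈ M, Valued.v ((ϖ ^ m)⁻¹ * (z -
        ((α - 1) * ((pairing σ ((StdForm.antidiagonal 3).over K) (f b 0) (f b 0))⁻¹ *
            (pairing σ ((StdForm.antidiagonal 3).over K) (f b 0) y * σ (pairing σ ((StdForm.antidiagonal 3).over K) (f b 0) y))) +
         (β - 1) * ((pairing σ ((StdForm.antidiagonal 3).over K) (f b 1) (f b 1))⁻¹ *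
            (pairing σ ((StdForm.antidiagonal 3).over K) (f b 1) y * σ (pairing σ ((StdForm.antidiagonal 3).over K) (f b 1) y)))))) ≤ 1} =
      {z | ∃ a : K, Valued.v a ≤ 1 ∧
        Valued.v ((ϖ ^ m)⁻¹ * (z - (ϖ - σ ϖ) * ((ϖ * σ ϖ) ^ ((d - d % 2) / 2))⁻¹ * (a * σ a))) ≤ 1} := by
  rw [LatticeLabelPlus, latticeValueSetMod_frameElt_sub_one hσσ, valueSetMod_xPlus]

end ValuedField

end Summit.HodgeConjecture.HodgeConjecture.Cruxes.H413.F0P3cDyRamFrameEltValueSet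

end
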